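import Summits.AtomisticToContinuum.Crystallization.Theorems.HullExactificationCascadeZeroDefectDensityLocalStructurePlanar
import HarnessLib

/-!
# Local structure of a soft twelve-shell — part 4/6: the quad, and the shapes in indexed form
# (route `HullExactificationCascade`, crux `ZeroDefectDensity`, stmt-AtomisticToContinuum-12086;
# line `birth`, stub `stub_localStructure`)

Support file (lead c5, stub-worker K3), continuing `…LocalStructurePlanar` (frame functions
`R, P, D, S`, `hF`, `orient3` as in `…LocalStructureFrame`).

* `rot_quad` — a large corner `(a, b)` at `v` (`D ∈ [-0.40, -0.30]`, positively oriented) and a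
  contact `w` of `a` with `|v w|² ∈ [1.94, 2.11]` positively oriented after `a` (seen from `v`) is a
  soft contact of `b` (`|w b| < 7/5`; in the ideal square `v a w b` of the cuboctahedron
  `|w b| = 1`), and the corners `(v, w)` at `b` and `(b, a)` at `w` are positively oriented
  (the fourth-vertex expansion `rotT_fourth`); the interval arithmetic is isolated in
  `rot_quad_real`;
* `rot_asmSS`, `rot_asmSL`, `rot_asmWedge`, `rot_asmTne` — the shape / wedge / non-radiality lemmas
  re-indexed over the stub's datum `p : Fin 12 → ℝ³` with its hypotheses `H1` (radii), `H2`
  (dichotomy).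

Mathlib + parts 1–3 only; no named fact is used. [folklore]
-/

noncomputable section

namespace Summit.AtomisticToContinuum.Crystallization.Theorems.ZeroDefectDensityBirth

open scoped RealInnerProductSpace
open Literature.Geometry.DiscreteGeometry

/-! ## The quad -/

/-- The far vertex `w` of a quad in the frame at `v`: with `t = ‖w‖² ∈ [1.94, 2.11]` and
`e = ‖w - c‖²`, `‖c‖²` in the squared band, `g = ⟪c, w⟫ ∈ [0.96949, 1.05551]` and
`R = ‖c‖² t - g² ∈ [0.9958, 1.0011]`. [folklore] -/
theorem rot_Wpoint {A2 t e g : ℝ} (hA : 0.9995 ≤ A2) (hA' : A2 ≤ 1.0005001) (ht : 1.94 ≤ t)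
    (ht' : t ≤ 2.11) (he : 0.9995 ≤ e) (he' : e ≤ 1.0005001) (hg : 2 * g = A2 + t - e) :
    0.96949 ≤ g ∧ g ≤ 1.05551 ∧ 0.9958 ≤ A2 * t - g ^ 2 ∧ A2 * t - g ^ 2 ≤ 1.0011 := by
  have hg1 : 0.96949 ≤ g := by linarith
  have hg2 : g ≤ 1.05551 := by linarith
  have key : A2 * t - g ^ 2 = A2 * e - (g - A2) ^ 2 := by linear_combination (-A2) * hg
  refine ⟨hg1, hg2, ?_, ?_⟩
  · rw [key]
    nlinarith [mul_le_mul hA he (by norm_num) (by linarith),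
      sq_le_sq' (by linarith : -0.05601 ≤ g - A2) (by linarith : g - A2 ≤ 0.05601)]
  · rw [key]
    nlinarith [mul_le_mul hA' he' (by linarith) (by norm_num : (0:ℝ) ≤ 1.0005001),
      sq_nonneg (g - A2)]

/-- Square root of the planar radius of the far vertex. [folklore] -/
theorem rot_sqrtRW {R : ℝ} (h1 : 0.9958 ≤ R) (h2 : R ≤ 1.0011) :
    0.9978 ≤ √R ∧ √R ≤ 1.00055 := by
  have h0 : 0 ≤ √R := Real.sqrt_nonneg R
  have hs : √R ^ 2 = R := Real.sq_sqrt (by linarith)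
  exact ⟨by nlinarith, by nlinarith⟩

/-- Planar product of a contact `a` of `v` with the far vertex `w` (`|a w|` in the band):
`P(a, w) ∈ [0.4825, 0.5301]` (with `h = ⟪a, w⟫`, `2h - 2g_w = ‖a‖² - ‖a - w‖² - ‖c‖² + ‖w - c‖²`).
[folklore] -/
theorem rot_PAW {A2 gA gW h δ : ℝ} (hA : 0.9995 ≤ A2) (hA' : A2 ≤ 1.0005001)
    (hgA : 0.49924 ≤ gA) (hgA' : gA ≤ 0.50076) (hgW : 0.96949 ≤ gW) (hgW' : gW ≤ 1.05551)
    (hδ : -0.0020002 ≤ δ) (hδ' : δ ≤ 0.0020002) (hh : 2 * h - 2 * gW = δ) :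
    0.4825 ≤ A2 * h - gA * gW ∧ A2 * h - gA * gW ≤ 0.5301 := by
  have key : A2 * h - gA * gW = gW * (A2 - gA) + A2 * (δ / 2) := by linear_combination A2 / 2 * hh
  rw [key]
  constructor
  · nlinarith [mul_le_mul hgW (by linarith : 0.49874 ≤ A2 - gA) (by norm_num) (by linarith),
      mul_le_mul_of_nonneg_left (by linarith : -0.0010001 ≤ δ / 2) (by linarith : (0:ℝ) ≤ A2)]
  · nlinarith [mul_le_mul hgW' (by linarith : A2 - gA ≤ 0.50127) (by linarith)
      (by norm_num : (0:ℝ) ≤ 1.05551),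
      mul_le_mul_of_nonneg_left (by linarith : δ / 2 ≤ 0.0010001) (by linarith : (0:ℝ) ≤ A2)]

/-- **The quad, scalar core.**  All the frame data of `rot_quad` as real numbers: norms, axis
components `g`, planar radii `r = √R`, the rotations `z(a→w), z(a→b), z(w→b)` with their defining
relations, the chord `d = |w b|` and the fourth-vertex expansion `h4`; conclusion `d < 7/5`,
`S(w,b) > 0` and `T_w > 0`.  Interval arithmetic, term by term. [folklore] -/
theorem rot_quad_real {nc gA gB gW rA rB rW t BB2 PAW DAW SAW DAB SAB DWB SWB TAW TAB TWB TW iWB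
    d : ℝ}
    (hc2 : 0.9995 ≤ nc ^ 2) (hc2' : nc ^ 2 ≤ 1.0005001) (hc0 : 0 < nc)
    (hnc : 1 - 1 / 4000 ≤ nc) (hnc' : nc ≤ 1 + 1 / 4000)
    (hgA' : gA ≤ 0.50076) (hgB : 0.49924 ≤ gB) (hgB' : gB ≤ 0.50076) (hgW : 0.96949 ≤ gW)
    (hrA : 0.86498 ≤ rA) (hrA' : rA ≤ 0.86707) (hrB : 0.86498 ≤ rB) (hrB' : rB ≤ 0.86707)
    (hrW : 0.9978 ≤ rW) (hrW' : rW ≤ 1.00055)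
    (ht' : t ≤ 2.11) (hBB' : BB2 ≤ 1.0005001)
    (hPAW : 0.4825 ≤ PAW) (hPAW' : PAW ≤ 0.5301) (mAW' : DAW * (rA * rW) = PAW)
    (uAW : DAW ^ 2 + SAW ^ 2 = 1) (uAB : DAB ^ 2 + SAB ^ 2 = 1) (sAW : 0 < SAW) (sAB : 0 < SAB)
    (hD1 : -0.40 ≤ DAB) (hD2 : DAB ≤ -0.30)
    (cWB : DWB = DAW * DAB - -SAW * SAB) (cWB' : SWB = -SAW * DAB + DAW * SAB)
    (mWB : SWB * (rW * rB) = nc * TWB) (mWB' : DWB * (rW * rB) = nc ^ 2 * iWB - gW * gB)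
    (mAW : SAW * (rA * rW) = nc * TAW) (mAB : SAB * (rA * rB) = nc * TAB)
    (hd : d ^ 2 = t + BB2 - 2 * iWB)
    (h4 : nc ^ 2 * TW = -TAB * (nc ^ 2 - gW) + TWB * (nc ^ 2 - gA) + TAW * (nc ^ 2 - gB)) :
    d < 7 / 5 ∧ 0 < SWB ∧ 0 < TW := by
  have rA0 : 0 < rA := by linarith
  have rB0 : 0 < rB := by linarith
  have rW0 : 0 < rW := by linarith
  have pAW : 0.86498 * 0.9978 ≤ rA * rW := mul_le_mul hrA hrW (by norm_num) rA0.le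
  have pAW' : rA * rW ≤ 0.86707 * 1.00055 := mul_le_mul hrA' hrW' rW0.le (by norm_num)
  have pWB : 0.9978 * 0.86498 ≤ rW * rB := mul_le_mul hrW hrB (by norm_num) rW0.le
  have pAB' : rA * rB ≤ 0.86707 * 0.86707 := mul_le_mul hrA' hrB' rB0.le (by norm_num)
  have dAW : 0.555 ≤ DAW := by
    by_contra h
    linarith only [mul_lt_mul_of_pos_right (not_le.mp h) (by positivity : 0 < rA * rW), mAW',
      hPAW, pAW']
  have dAW' : DAW ≤ 0.615 := by
    by_contra h
    linarith only [mul_lt_mul_of_pos_right (not_le.mp h) (by positivity : 0 < rA * rW), mAW',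
      hPAW', pAW]
  obtain ⟨q1, q2, q3⟩ := rot2_quad uAW uAB dAW dAW' sAW hD1 hD2 sAB
  obtain ⟨-, lAB'⟩ := rot2_sinL uAB hD1 hD2 sAB
  have dWB : 0.476 ≤ DWB := by rw [cWB]; linarith only [q1]
  have sWB : 0.745 ≤ SWB := by rw [cWB']; linarith only [q2]
  have hin : 0.894 ≤ iWB := by
    by_contra h
    linarith only [mul_lt_mul_of_pos_left (not_le.mp h) (by positivity : (0:ℝ) < nc ^ 2),
      mul_le_mul hgW hgB (by norm_num) (by linarith only [hgW] : 0 ≤ gW),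
      mul_le_mul dWB pWB (by norm_num) (by linarith only [dWB] : 0 ≤ DWB), mWB', hc2']
  refine ⟨?_, by linarith only [sWB], ?_⟩
  · by_contra h
    linarith only [pow_le_pow_left₀ (by norm_num : (0:ℝ) ≤ 7 / 5) (not_lt.mp h) 2, hd, ht', hBB',
      hin]
  · have tWB : 0.642 ≤ TWB := by
      by_contra h
      linarith only [mul_lt_mul_of_pos_left (not_le.mp h) hc0,
        mul_le_mul sWB pWB (by norm_num) (by linarith only [sWB] : 0 ≤ SWB), mWB, hnc']
    have tAW' : 0.679 ≤ TAW := by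
      by_contra h
      linarith only [mul_lt_mul_of_pos_left (not_le.mp h) hc0,
        mul_le_mul q3 pAW (by norm_num) (by linarith only [q3] : 0 ≤ SAW), mAW, hnc']
    have tAB0 : 0 < TAB :=
      pos_of_mul_pos_right (by rw [← mAB]; positivity) hc0.le
    have tAB' : TAB ≤ 0.718 := by
      by_contra h
      linarith only [mul_lt_mul_of_pos_left (not_le.mp h) hc0,
        mul_le_mul lAB' pAB' (by positivity) (by norm_num : (0:ℝ) ≤ 0.95394), mAB, hnc]
    have e1 : -0.0223 ≤ -TAB * (nc ^ 2 - gW) := by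
      rcases le_or_gt 0 (nc ^ 2 - gW) with h | h
      · linarith only [mul_le_mul tAB' (by linarith only [hc2', hgW] : nc ^ 2 - gW ≤ 0.031011) h
          (by norm_num : (0:ℝ) ≤ 0.718)]
      · linarith only [mul_pos tAB0 (neg_pos.mpr h)]
    have e2 : 0.3201 ≤ TWB * (nc ^ 2 - gA) := by
      linarith only [mul_le_mul tWB (by linarith only [hc2, hgA'] : 0.49874 ≤ nc ^ 2 - gA)
        (by norm_num) (by linarith only [tWB] : 0 ≤ TWB)]
    have e3 : 0.3386 ≤ TAW * (nc ^ 2 - gB) := by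
      linarith only [mul_le_mul tAW' (by linarith only [hc2, hgB'] : 0.49874 ≤ nc ^ 2 - gB)
        (by norm_num) (by linarith only [tAW'] : 0 ≤ TAW)]
    have : 0 < nc ^ 2 * TW := by linarith only [h4, e1, e2, e3]
    exact pos_of_mul_pos_right this (by positivity)

variable {R : EuclideanSpace ℝ (Fin 3) → EuclideanSpace ℝ (Fin 3) → ℝ}
  {P D S : EuclideanSpace ℝ (Fin 3) → EuclideanSpace ℝ (Fin 3) → EuclideanSpace ℝ (Fin 3) → ℝ}
  (hF : (∀ c x, R c x = ‖c‖ ^ 2 * ‖x‖ ^ 2 - ⟪c, x⟫ ^ 2) ∧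
    (∀ c x y, P c x y = ‖c‖ ^ 2 * ⟪x, y⟫ - ⟪c, x⟫ * ⟪c, y⟫) ∧
    (∀ c x y, D c x y = P c x y / (√(R c x) * √(R c y))) ∧
    (∀ c x y, S c x y = ‖c‖ * orient3 c x y / (√(R c x) * √(R c y))))
include hF

/-- **The quad.**  `a, b` contacts of the shell point `v` forming a positively oriented LARGE corner
(`D(a,b) ∈ [-0.40, -0.30]`, `T(a,b) > 0`), and `w` a shell point in contact with `a`, with
`|v w|² ∈ [1.94, 2.11]`, positively oriented after `a` (`T(a,w) > 0`, all in the frame at `v`):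
then `|w b| < 7/5`, `T(w, b) > 0`, and at `w` the corner `(b, a)` is positively oriented.
[folklore] -/
theorem rot_quad {u V A B W : EuclideanSpace ℝ (Fin 3)}
    (hV : 1 - 1 / 4000 ≤ dist u V ∧ dist u V ≤ 1 + 1 / 4000)
    (hA : 1 - 1 / 4000 ≤ dist u A ∧ dist u A ≤ 1 + 1 / 4000)
    (hVA : 1 - 1 / 4000 ≤ dist V A ∧ dist V A ≤ 1 + 1 / 4000)
    (hB : 1 - 1 / 4000 ≤ dist u B ∧ dist u B ≤ 1 + 1 / 4000)
    (hVB : 1 - 1 / 4000 ≤ dist V B ∧ dist V B ≤ 1 + 1 / 4000)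
    (hW : 1 - 1 / 4000 ≤ dist u W ∧ dist u W ≤ 1 + 1 / 4000)
    (hAW : 1 - 1 / 4000 ≤ dist A W ∧ dist A W ≤ 1 + 1 / 4000)
    (hVW : 1.94 ≤ dist V W ^ 2 ∧ dist V W ^ 2 ≤ 2.11)
    (hD1 : -0.40 ≤ D (u - V) (A - V) (B - V)) (hD2 : D (u - V) (A - V) (B - V) ≤ -0.30)
    (tAB : 0 < orient3 (u - V) (A - V) (B - V)) (tAW : 0 < orient3 (u - V) (A - V) (W - V)) :
    dist W B < 7 / 5 ∧ 0 < orient3 (u - V) (W - V) (B - V) ∧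
      0 < orient3 (u - W) (B - W) (A - W) := by
  obtain ⟨⟨gA, gA', RA, RA', RA0⟩, ⟨BA, BA'⟩, ⟨hc2, hc2', hc0, hc⟩⟩ := rot_vpoint hF hV hA hVA
  obtain ⟨⟨gB, gB', RB, RB', RB0⟩, ⟨BB, BB'⟩, -⟩ := rot_vpoint hF hV hB hVB
  obtain ⟨sA, sA'⟩ := rot_sqrtR RA RA'
  obtain ⟨sB, sB'⟩ := rot_sqrtR RB RB'
  rw [dist_comm, dist_eq_norm] at hVW
  rw [dist_comm, dist_eq_norm, ← sub_sub_sub_cancel_right W u V] at hW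
  rw [dist_eq_norm, ← sub_sub_sub_cancel_right A W V] at hAW
  rw [dist_eq_norm] at hV
  obtain ⟨he, he', -⟩ := rot_band hW.1 hW.2
  obtain ⟨hf, hf', -⟩ := rot_band hAW.1 hAW.2
  have hgW : 2 * ⟪u - V, W - V⟫ = ‖u - V‖ ^ 2 + ‖W - V‖ ^ 2 - ‖W - V - (u - V)‖ ^ 2 := by
    rw [norm_sub_sq_real (W - V) (u - V), real_inner_comm (u - V) (W - V)]; ring
  obtain ⟨gW, gW', RW, RW'⟩ := rot_Wpoint hc2 hc2' hVW.1 hVW.2 he he' hgW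
  rw [← hF.1 (u - V) (W - V)] at RW RW'
  have RW0 : 0 < R (u - V) (W - V) := by linarith
  obtain ⟨sW, sW'⟩ := rot_sqrtRW RW RW'
  have hh : 2 * ⟪A - V, W - V⟫ - 2 * ⟪u - V, W - V⟫ =
      ‖A - V‖ ^ 2 - ‖A - V - (W - V)‖ ^ 2 - ‖u - V‖ ^ 2 + ‖W - V - (u - V)‖ ^ 2 := by
    rw [norm_sub_sq_real (W - V) (u - V), norm_sub_sq_real (A - V) (W - V),
      real_inner_comm (u - V) (W - V)]; ring
  obtain ⟨PAW, PAW'⟩ := rot_PAW hc2 hc2' gA gA' gW gW' (by linarith) (by linarith) hh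
  have sAW := (rotS_pos_iff hF hc RA0 RW0).mpr tAW
  have sAB := (rotS_pos_iff hF hc RA0 RB0).mpr tAB
  obtain ⟨cWB, cWB'⟩ := rot_comp hF RW0 RA0 RB0
  rw [rotD_swap hF (u - V) (A - V) (W - V), rotS_swap hF (u - V) (A - V) (W - V)] at cWB cWB'
  have h4 := rotT_fourth (u - V) (W - V) (B - V) (A - V)
  rw [sub_sub_sub_cancel_right, sub_sub_sub_cancel_right, sub_sub_sub_cancel_right,
    orient3_swap_right (u - V) (B - V) (A - V)] at h4
  have hdist : dist W B ^ 2 = ‖W - V‖ ^ 2 + ‖B - V‖ ^ 2 - 2 * ⟪W - V, B - V⟫ := by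
    rw [dist_eq_norm, ← sub_sub_sub_cancel_right W B V, norm_sub_sq_real]; ring
  obtain ⟨g1, g2, g3⟩ := rot_quad_real (TW := orient3 (u - W) (B - W) (A - W)) hc2 hc2' hc0 hV.1
    hV.2 gA' gB gB' gW sA sA' sB sB' sW sW' hVW.2 BB' PAW PAW' (rotD_mul hF RA0 RW0)
    (rot_unit hF RA0 RW0) (rot_unit hF RA0 RB0) sAW sAB hD1 hD2 cWB cWB' (rotS_mul hF RW0 RB0)
    (rotD_mul hF RW0 RB0) (rotS_mul hF RA0 RW0) (rotS_mul hF RA0 RB0) hdist h4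
  exact ⟨g1, (rotS_pos_iff hF hc RW0 RB0).mp g2, g3⟩


/-! ## The two vertex shapes, indexed form -/

/-- **Shape SS, indexed.**  Contacts `k₀, …, k₃` of `v` with `k₀k₁`, `k₁k₂` in contact, `k₂k₃`,
`k₃k₀` not, and `T(k₀,k₁), T(k₁,k₂) > 0`: all four corners are positively oriented, the
non-contact corners have `D ∈ [-0.40, -0.30]`, the diagonals `|·|² ≥ 2.6`. [folklore] -/
theorem rot_asmSS (u : EuclideanSpace ℝ (Fin 3)) (p : Fin 12 → EuclideanSpace ℝ (Fin 3))
    (H1 : ∀ i : Fin 12, 1 - 1 / 4000 ≤ dist u (p i) ∧ dist u (p i) ≤ 1 + 1 / 4000)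
    (H2 : ∀ i j : Fin 12, i ≠ j → 1 - 1 / 4000 ≤ dist (p i) (p j) ∧
      (dist (p i) (p j) ≤ 1 + 1 / 4000 ∨ 7 / 5 ≤ dist (p i) (p j)))
    (v k0 k1 k2 k3 : Fin 12)
    (hk0 : k0 ≠ v ∧ dist (p v) (p k0) ≤ 1 + 1 / 4000)
    (hk1 : k1 ≠ v ∧ dist (p v) (p k1) ≤ 1 + 1 / 4000)
    (hk2 : k2 ≠ v ∧ dist (p v) (p k2) ≤ 1 + 1 / 4000)
    (hk3 : k3 ≠ v ∧ dist (p v) (p k3) ≤ 1 + 1 / 4000)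
    (n01 : k0 ≠ k1) (n03 : k0 ≠ k3) (n12 : k1 ≠ k2) (n23 : k2 ≠ k3)
    (c01 : dist (p k0) (p k1) ≤ 1 + 1 / 4000) (c12 : dist (p k1) (p k2) ≤ 1 + 1 / 4000)
    (f23 : ¬dist (p k2) (p k3) ≤ 1 + 1 / 4000) (f30 : ¬dist (p k3) (p k0) ≤ 1 + 1 / 4000)
    (t01 : 0 < orient3 (u - p v) (p k0 - p v) (p k1 - p v))
    (t12 : 0 < orient3 (u - p v) (p k1 - p v) (p k2 - p v)) :
    0 < orient3 (u - p v) (p k0 - p v) (p k1 - p v) ∧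
      0 < orient3 (u - p v) (p k1 - p v) (p k2 - p v) ∧
      0 < orient3 (u - p v) (p k2 - p v) (p k3 - p v) ∧
      0 < orient3 (u - p v) (p k3 - p v) (p k0 - p v) ∧
      (¬dist (p k1) (p k2) ≤ 1 + 1 / 4000 →
        -0.40 ≤ D (u - p v) (p k1 - p v) (p k2 - p v) ∧
          D (u - p v) (p k1 - p v) (p k2 - p v) ≤ -0.30) ∧
      (¬dist (p k2) (p k3) ≤ 1 + 1 / 4000 →
        -0.40 ≤ D (u - p v) (p k2 - p v) (p k3 - p v) ∧
          D (u - p v) (p k2 - p v) (p k3 - p v) ≤ -0.30) ∧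
      (¬dist (p k3) (p k0) ≤ 1 + 1 / 4000 →
        -0.40 ≤ D (u - p v) (p k3 - p v) (p k0 - p v) ∧
          D (u - p v) (p k3 - p v) (p k0 - p v) ≤ -0.30) ∧
      2.6 ≤ dist (p k0) (p k2) ^ 2 ∧ 2.6 ≤ dist (p k1) (p k3) ^ 2 := by
  have hV := H1 v
  have b0 : 1 - 1 / 4000 ≤ dist (p v) (p k0) ∧ dist (p v) (p k0) ≤ 1 + 1 / 4000 :=
    ⟨(H2 v k0 hk0.1.symm).1, hk0.2⟩
  have b1 : 1 - 1 / 4000 ≤ dist (p v) (p k1) ∧ dist (p v) (p k1) ≤ 1 + 1 / 4000 :=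
    ⟨(H2 v k1 hk1.1.symm).1, hk1.2⟩
  have b2 : 1 - 1 / 4000 ≤ dist (p v) (p k2) ∧ dist (p v) (p k2) ≤ 1 + 1 / 4000 :=
    ⟨(H2 v k2 hk2.1.symm).1, hk2.2⟩
  have b3 : 1 - 1 / 4000 ≤ dist (p v) (p k3) ∧ dist (p v) (p k3) ≤ 1 + 1 / 4000 :=
    ⟨(H2 v k3 hk3.1.symm).1, hk3.2⟩
  have g23 : 7 / 5 ≤ dist (p k2) (p k3) := ((H2 k2 k3 n23).2.resolve_left f23)
  have g30 : 7 / 5 ≤ dist (p k3) (p k0) := ((H2 k3 k0 n03.symm).2.resolve_left f30)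
  obtain ⟨t23, t30, w23, w30, d02, d13⟩ := rot_shapeSS hF hV (H1 k0) b0 (H1 k1) b1 (H1 k2) b2
    (H1 k3) b3 ⟨(H2 k0 k1 n01).1, c01⟩ ⟨(H2 k1 k2 n12).1, c12⟩ g23 g30 t01 t12
  exact ⟨t01, t12, t23, t30, fun h => absurd c12 h, fun _ => w23, fun _ => w30,
    rot_vdiag hF hV (H1 k0) b0 (H1 k2) b2 d02, rot_vdiag hF hV (H1 k1) b1 (H1 k3) b3 d13⟩

/-- **Shape SL, indexed.**  Contacts `k₀, …, k₃` of `v` with `k₀k₁`, `k₂k₃` in contact, `k₁k₂`,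
`k₃k₀` not, and `T(k₀,k₁), T(k₂,k₃) > 0`: the same conclusion as `rot_asmSS`. [folklore] -/
theorem rot_asmSL (u : EuclideanSpace ℝ (Fin 3)) (p : Fin 12 → EuclideanSpace ℝ (Fin 3))
    (H1 : ∀ i : Fin 12, 1 - 1 / 4000 ≤ dist u (p i) ∧ dist u (p i) ≤ 1 + 1 / 4000)
    (H2 : ∀ i j : Fin 12, i ≠ j → 1 - 1 / 4000 ≤ dist (p i) (p j) ∧
      (dist (p i) (p j) ≤ 1 + 1 / 4000 ∨ 7 / 5 ≤ dist (p i) (p j)))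
    (v k0 k1 k2 k3 : Fin 12)
    (hk0 : k0 ≠ v ∧ dist (p v) (p k0) ≤ 1 + 1 / 4000)
    (hk1 : k1 ≠ v ∧ dist (p v) (p k1) ≤ 1 + 1 / 4000)
    (hk2 : k2 ≠ v ∧ dist (p v) (p k2) ≤ 1 + 1 / 4000)
    (hk3 : k3 ≠ v ∧ dist (p v) (p k3) ≤ 1 + 1 / 4000)
    (n01 : k0 ≠ k1) (n03 : k0 ≠ k3) (n12 : k1 ≠ k2) (n23 : k2 ≠ k3)
    (c01 : dist (p k0) (p k1) ≤ 1 + 1 / 4000) (c23 : dist (p k2) (p k3) ≤ 1 + 1 / 4000)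
    (f12 : ¬dist (p k1) (p k2) ≤ 1 + 1 / 4000) (f30 : ¬dist (p k3) (p k0) ≤ 1 + 1 / 4000)
    (t01 : 0 < orient3 (u - p v) (p k0 - p v) (p k1 - p v))
    (t23 : 0 < orient3 (u - p v) (p k2 - p v) (p k3 - p v)) :
    0 < orient3 (u - p v) (p k0 - p v) (p k1 - p v) ∧
      0 < orient3 (u - p v) (p k1 - p v) (p k2 - p v) ∧
      0 < orient3 (u - p v) (p k2 - p v) (p k3 - p v) ∧
      0 < orient3 (u - p v) (p k3 - p v) (p k0 - p v) ∧
      (¬dist (p k1) (p k2) ≤ 1 + 1 / 4000 →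
        -0.40 ≤ D (u - p v) (p k1 - p v) (p k2 - p v) ∧
          D (u - p v) (p k1 - p v) (p k2 - p v) ≤ -0.30) ∧
      (¬dist (p k2) (p k3) ≤ 1 + 1 / 4000 →
        -0.40 ≤ D (u - p v) (p k2 - p v) (p k3 - p v) ∧
          D (u - p v) (p k2 - p v) (p k3 - p v) ≤ -0.30) ∧
      (¬dist (p k3) (p k0) ≤ 1 + 1 / 4000 →
        -0.40 ≤ D (u - p v) (p k3 - p v) (p k0 - p v) ∧
          D (u - p v) (p k3 - p v) (p k0 - p v) ≤ -0.30) ∧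
      2.6 ≤ dist (p k0) (p k2) ^ 2 ∧ 2.6 ≤ dist (p k1) (p k3) ^ 2 := by
  have hV := H1 v
  have b0 : 1 - 1 / 4000 ≤ dist (p v) (p k0) ∧ dist (p v) (p k0) ≤ 1 + 1 / 4000 :=
    ⟨(H2 v k0 hk0.1.symm).1, hk0.2⟩
  have b1 : 1 - 1 / 4000 ≤ dist (p v) (p k1) ∧ dist (p v) (p k1) ≤ 1 + 1 / 4000 :=
    ⟨(H2 v k1 hk1.1.symm).1, hk1.2⟩
  have b2 : 1 - 1 / 4000 ≤ dist (p v) (p k2) ∧ dist (p v) (p k2) ≤ 1 + 1 / 4000 :=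
    ⟨(H2 v k2 hk2.1.symm).1, hk2.2⟩
  have b3 : 1 - 1 / 4000 ≤ dist (p v) (p k3) ∧ dist (p v) (p k3) ≤ 1 + 1 / 4000 :=
    ⟨(H2 v k3 hk3.1.symm).1, hk3.2⟩
  have g12 : 7 / 5 ≤ dist (p k1) (p k2) := ((H2 k1 k2 n12).2.resolve_left f12)
  have g30 : 7 / 5 ≤ dist (p k3) (p k0) := ((H2 k3 k0 n03.symm).2.resolve_left f30)
  obtain ⟨t12, t30, w12, w30, d02, d13⟩ := rot_shapeSL hF hV (H1 k0) b0 (H1 k1) b1 (H1 k2) b2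
    (H1 k3) b3 ⟨(H2 k0 k1 n01).1, c01⟩ ⟨(H2 k2 k3 n23).1, c23⟩ g12 g30 t01 t23
  exact ⟨t01, t12, t23, t30, fun _ => w12, fun h => absurd c23 h, fun _ => w30,
    rot_vdiag hF hV (H1 k0) b0 (H1 k2) b2 d02, rot_vdiag hF hV (H1 k1) b1 (H1 k3) b3 d13⟩

/-- **The wedge, indexed**: contacts `x, m, y` of `v` with `x m`, `m y` in contact:
`T(m,x) T(m,y) < 0`. [folklore] -/
theorem rot_asmWedge (u : EuclideanSpace ℝ (Fin 3)) (p : Fin 12 → EuclideanSpace ℝ (Fin 3))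
    (H1 : ∀ i : Fin 12, 1 - 1 / 4000 ≤ dist u (p i) ∧ dist u (p i) ≤ 1 + 1 / 4000)
    (H2 : ∀ i j : Fin 12, i ≠ j → 1 - 1 / 4000 ≤ dist (p i) (p j) ∧
      (dist (p i) (p j) ≤ 1 + 1 / 4000 ∨ 7 / 5 ≤ dist (p i) (p j)))
    (v x m y : Fin 12)
    (hx : x ≠ v ∧ dist (p v) (p x) ≤ 1 + 1 / 4000) (hm : m ≠ v ∧ dist (p v) (p m) ≤ 1 + 1 / 4000)
    (hy : y ≠ v ∧ dist (p v) (p y) ≤ 1 + 1 / 4000) (nmx : m ≠ x) (nmy : m ≠ y) (nxy : x ≠ y)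
    (cmx : dist (p m) (p x) ≤ 1 + 1 / 4000) (cmy : dist (p m) (p y) ≤ 1 + 1 / 4000) :
    orient3 (u - p v) (p m - p v) (p x - p v) * orient3 (u - p v) (p m - p v) (p y - p v) < 0 :=
  rot_vwedge hF (H1 v) (H1 x) ⟨(H2 v x hx.1.symm).1, hx.2⟩ (H1 m) ⟨(H2 v m hm.1.symm).1, hm.2⟩
    (H1 y) ⟨(H2 v y hy.1.symm).1, hy.2⟩ ⟨(H2 m x nmx).1, cmx⟩ ⟨(H2 m y nmy).1, cmy⟩ (H2 x y nxy).1

/-- **Contact pairs are not radial, indexed**: `T(x, y) ≠ 0` for a contact pair `x y` of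
contacts of `v`. [folklore] -/
theorem rot_asmTne (u : EuclideanSpace ℝ (Fin 3)) (p : Fin 12 → EuclideanSpace ℝ (Fin 3))
    (H1 : ∀ i : Fin 12, 1 - 1 / 4000 ≤ dist u (p i) ∧ dist u (p i) ≤ 1 + 1 / 4000)
    (H2 : ∀ i j : Fin 12, i ≠ j → 1 - 1 / 4000 ≤ dist (p i) (p j) ∧
      (dist (p i) (p j) ≤ 1 + 1 / 4000 ∨ 7 / 5 ≤ dist (p i) (p j)))
    (v x y : Fin 12)
    (hx : x ≠ v ∧ dist (p v) (p x) ≤ 1 + 1 / 4000) (hy : y ≠ v ∧ dist (p v) (p y) ≤ 1 + 1 / 4000)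
    (nxy : x ≠ y) (cxy : dist (p x) (p y) ≤ 1 + 1 / 4000) :
    orient3 (u - p v) (p x - p v) (p y - p v) ≠ 0 :=
  rot_vT_ne_zero hF (H1 v) (H1 x) ⟨(H2 v x hx.1.symm).1, hx.2⟩ (H1 y) ⟨(H2 v y hy.1.symm).1, hy.2⟩
    ⟨(H2 x y nxy).1, cxy⟩

omit hF in
/-- **The wedge on the shell** (registered sub-goal `rot_wedgeShell` of `stub_localStructure`,
one line): the closed form of `rot_asmWedge`. [folklore] -/
theorem rot_wedgeShell : ∀ (u : EuclideanSpace ℝ (Fin 3)) (p : Fin 12 → EuclideanSpace ℝ (Fin 3)), (∀ i : Fin 12, 1 - 1 / 4000 ≤ dist u (p i) ∧ dist u (p i) ≤ 1 + 1 / 4000) → (∀ i j : Fin 12, i ≠ j → 1 - 1 / 4000 ≤ dist (p i) (p j) ∧ (dist (p i) (p j) ≤ 1 + 1 / 4000 ∨ 7 / 5 ≤ dist (p i) (p j))) → ∀ (v x m y : Fin 12), x ≠ v → dist (p v) (p x) ≤ 1 + 1 / 4000 → m ≠ v → dist (p v) (p m) ≤ 1 + 1 / 4000 → y ≠ v → dist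 (p v) (p y) ≤ 1 + 1 / 4000 → m ≠ x → m ≠ y → x ≠ y → dist (p m) (p x) ≤ 1 + 1 / 4000 → dist (p m) (p y) ≤ 1 + 1 / 4000 → Literature.Geometry.DiscreteGeometry.orient3 (u - p v) (p m - p v) (p x - p v) * Literature.Geometry.DiscreteGeometry.orient3 (u - p v) (p m - p v) (p y - p v) < 0 := by
  intro u p H1 H2 v x m y hx hcx hm hcm hy hcy nmx nmy nxy cmx cmy
  obtain ⟨R, P, D, S, hF⟩ := rot_frame_exists
  exact rot_asmWedge hF u p H1 H2 v x m y ⟨hx, hcx⟩ ⟨hm, hcm⟩ ⟨hy, hcy⟩ nmx nmy nxy cmx cmy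

end Summit.AtomisticToContinuum.Crystallization.Theorems.ZeroDefectDensityBirth
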